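import Mathlib
import HarnessLib
import Summits.NavierStokesRegularity.NavierStokesRegularity.Theses.LocalIrrotationalScarDoor
import Summits.NavierStokesRegularity.NavierStokesRegularity.Theorems.RellichScarApexLocalisationIrrotHalfspaceLiouville

/-!
# Route `LocalIrrotationalScarDoor` (door S15, nsreg-p1 ROUND-14) — birth closer for the item `IrrotationalHalfspaceScarLiouvilleRep`

Filed by nsreg-p6 (the door is MOOT-BY-PROOF: K1Rep p493989, K2Rep p489778, Target p494432 are tree theorems).
WHAT THIS IS NOT: not NS regularity — a by-name link from the route item to a tree theorem.
-/

noncomputable section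

-- the summit and its single sub-problem share the name (CONVENTIONS §1), as in every Theorems file
set_option linter.dupNamespace false

namespace Summit.NavierStokesRegularity.NavierStokesRegularity.Theorems.LocalIrrotationalScarDoorK2RepClose

/-- **K2Rep holds** (birth closer): the route item `IrrotationalHalfspaceScarLiouvilleRep` follows by name from the kit
theorem `…Theorems.RellichScarApexLocalisationIrrotHalfspaceLiouville.not_isBackwardSingularPoint_of_topCurlVanishing_halfspace`
(nsreg-p1 g12's kit, landed p489778). -/
theorem irrotationalHalfspaceScarLiouvilleRep_proof : Summit.NavierStokesRegularity.NavierStokesRegularity.Theses.LocalIrrotationalScarDoor.IrrotationalHalfspaceScarLiouvilleRep :=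
  fun _C _e he _w _π _H _Uc hsw hwg hI hapex hUc hUcc htopc =>
    Summit.NavierStokesRegularity.NavierStokesRegularity.Theorems.RellichScarApexLocalisationIrrotHalfspaceLiouville.not_isBackwardSingularPoint_of_topCurlVanishing_halfspace
      hsw hwg hI hapex he hUc hUcc htopc

end Summit.NavierStokesRegularity.NavierStokesRegularity.Theorems.LocalIrrotationalScarDoorK2RepClose

end
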